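/-
Copyright (c) 2026 the pub-hodgecm-mathlib formalisation cell (harness21).  Prover seat hodgecm-mathlib-K2E5-p16 (g7), Track B «K2-LIT»,
#184♮ = hLiu418 = `stmt-HodgeConjecture-24832`; #42S organ S2, S2-asm road (γ), FILE 5b `K2LiuArchReadingChartPlaceSecArch` (S2 desk K2Liu-p05 (g6)
15:21:01Z ∕ 15:26:46Z «(F2′) in the `hιψ` bytes of ★ `hcurve_of_frame`»; LEAD F0P6-plan (g14) BATCH #47).  THEOREMS ONLY (no `def`, no `instance`, no notation,
no named-fact hypothesis, no `sorry`); the Mathlib idiom `attribute [local instance 100] LieRing.ofAssociativeRing` (`Mathlib/Algebra/Lie/OfAssociative.lean`,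
needed to NAME `↥(uFormGroup (Fin n) (Fin n)).lie.toSubmodule` and `s • Y′` in ★ `hcurve_of_frame`'s own bytes; exactly as ★ p860738 ∕ ★ p861294 ∕ ★ `JunctionLinearRealGroup`).
-/
import Summits.HodgeConjecture.HodgeConjecture.Theorems.K2LiuArchReadingChartPlaceSec    -- ★ FILE 5 (ring half): `frameInv_cayley_conj_frame`
import Summits.HodgeConjecture.HodgeConjecture.Theorems.K2LiuArchReadingFrameSign        -- ★ FILE 3: `re_embedding_cmPlaceOver_eq` (+ ★ `signVec_doubled_inl∕inr`, ★ `tw_ne_zero`)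
import Summits.HodgeConjecture.HodgeConjecture.Theorems.K2LiuArchSectionPlaceBlock       -- ★ `placeSec`, `placeSec_apply`, `formCongr_signFrame_eq`
import Summits.HodgeConjecture.HodgeConjecture.Theorems.K2LiuArchTubeCurveAlgebra         -- ★ p861184 `exp_smul_cayley_conj`
import Summits.HodgeConjecture.HodgeConjecture.Theorems.K2LiuLieRayDifferentiability      -- ★ `conjTranspose_exp_mul_J_mul_exp`
import Literature.RepresentationTheory.KonnoKonno2007.JunctionLinearRealGroup             -- ★ `uFormGroup`, `uFormGroup_regular`, `coe_mem_uFormGroup_carrier`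
import Literature.RepresentationTheory.KonnoKonno2007.RealUnitaryDualPairRelabel          -- ★ `UForm.relabel`, `UForm.coe_relabel`
import Literature.Analysis.Matrix.KroneckerSumExp                                          -- ★ `exp_reindex`
import HarnessLib

/-!
# Crux `HLiu418`, organ S2 (frames), FILE 5b: the reading chart through the one-place section `placeSec σ` — the letter (F2′)

Cell `hodgecm-mathlib`, crux item hLiu418 = `stmt-HodgeConjecture-24832` (helper lane `--supports`, count-neutral).  At the complex place `w(σ)` above a real
place `σ` of `L⁺`, ★ FILE 4's reading chart `ι_{w(σ)} : U(J)(ℂ) → U(σ_{w(σ)} hermD)(ℂ)`, `P ↦ (T⁻¹ P T)^{e₂}` (`T` Shimura's sign-adapted tube frame), read in the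
canonical sign frame `toUFormEquiv_σ : U(σ_{w(σ)} hermD)(ℂ) ≃ U(𝔻⁺_σ, 𝔻⁻_σ)` and then in ANY block identification `(eSp, eSq) : Fin n ⊕ Fin n ≃ 𝔻⁺_σ ⊕ 𝔻⁻_σ`,
is a COORDINATE PERMUTATION of the diagonal picture `M = C′ P C`:

* §1 `sqrt_cancel`, `slot_involutive` — the scalar identity `√(A∕|c|)·√(A∕2)⁻¹ · z · √(B∕2)·√(B∕|c|)⁻¹ = z` and the slot involution `π_t`;
* §2 `sqrtAbs_signVec_doubled` — the Sylvester scaling of the doubled frame is `D_σ(e₂ p) = √(|t_p̄| ∕ |c_σ|)` (★ FILE 3's sign dictionary);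
  `coe_relabel_symm_toUFormEquiv` — the matrix of `relabel⁻¹ (toUFormEquiv_σ k)` is `((D_σ k D_σ⁻¹)^{ε_σ})^{eSp ⊕ eSq}`;
  **`coe_relabel_symm_toUFormEquiv_readingChart`** — for `P = C M C′ ∈ U(J)`: the matrix of `relabel⁻¹ (toUFormEquiv_σ (ι P))` is `M ∘ (θ × θ)`,
  `θ = π_t ∘ e₂⁻¹ ∘ ε_σ⁻¹ ∘ (eSp ⊕ eSq)` (★ FILE 5 `frameInv_cayley_conj_frame` + §1: ALL the scalings cancel);
* §3 **`exists_lie_exp_readingChart_eq_placeSec_relabel`** = the letter **(F2′)** of ★ p861294 `K2LiuArchTubeCurveReading.hcurve_of_frame` (its `hιψ`, with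
  `w := cmPlaceOver L σ`, `ψ := placeSec_𝔻 σ ∘ UForm.relabel eSp eSq` as in ★ K2Liu-p25 `K2LiuArchJunctionFrameData.hsec_placeSec_relabel`): for every
  `X = C A C′` with `Xᴴ J + J X = 0` there is `Y′ ∈ 𝔲(n,n)` — namely `Y′ = A ∘ (θ × θ)`, a Lie element because all its exponentials are values of the chart
  (★ `uFormGroup_regular`) — with `archPiEquivCM⁻¹ (mulSingle w(σ) (ι (exp sX))) = ψ (exp (sY′))` for all real `s` (★ `exp_smul_cayley_conj`, ★ `exp_reindex`,
  ★ `conjTranspose_exp_mul_J_mul_exp`, ★ `placeSec_apply`, ★ `archSingle_apply`).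
References: [Shimura1997, §6]; [Knapp1986, Ch. VI §2]; [KonnoKonno2007, §3.1]; [BorelJacquet1979, §4.1]; [PlatonovRapinchuk1994, §2.3].
HONEST LABEL: HC_CM is proved only modulo the 7 printed citations (2 remaining named inputs: hLiu418 = stmt-HodgeConjecture-24832,
h413 = stmt-HodgeConjecture-24833) until rung 0 closes; count-neutral helper, closes no socket.
-/

set_option autoImplicit false
set_option linter.dupNamespace false

noncomputable section

-- Mathlib idiom (`Mathlib/Algebra/Lie/OfAssociative.lean`, as ★ `RealMatrixGroups` ∕ ★ `JunctionLinearRealGroup` ∕ ★ p861294 `hcurve_of_frame`): the commutator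
-- bracket on `Matrix _ _ ℂ`, needed to name `↥(uFormGroup (Fin n) (Fin n)).lie.toSubmodule` and `s • Y′` in (F2′)'s statement (★'s bytes); overrides nothing.
attribute [local instance 100] LieRing.ofAssociativeRing

namespace Summit.HodgeConjecture.HodgeConjecture.Cruxes.HLiu418.K2LiuArchReadingChartPlaceSecArch

open Matrix Complex NumberField NumberField.InfinitePlace
open scoped MatrixGroups ComplexConjugate Classical

/-! ## §1 Two elementary letters -/

section Elementary

/-- `√(A∕|c|) · (√(A∕2)⁻¹ · z · √(B∕2)) · √(B∕|c|)⁻¹ = z` for `A, B > 0`, `c ≠ 0` (the Sylvester scaling against Shimura's frame scaling). [folklore] -/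
theorem sqrt_cancel (A B c : ℝ) (hA : 0 < A) (hB : 0 < B) (hc : c ≠ 0) (z : ℂ) :
    ((Real.sqrt (A / |c|) : ℝ) : ℂ) * ((((Real.sqrt (A / 2) : ℝ) : ℂ))⁻¹ * z * ((Real.sqrt (B / 2) : ℝ) : ℂ)) * (((Real.sqrt (B / |c|) : ℝ) : ℂ))⁻¹ = z := by
  have hc' : 0 < |c| := abs_pos.2 hc
  rw [Real.sqrt_div hA.le, Real.sqrt_div hA.le, Real.sqrt_div hB.le, Real.sqrt_div hB.le]
  have hsA : (Real.sqrt A : ℂ) ≠ 0 := ofReal_ne_zero.2 (Real.sqrt_pos.2 hA).ne'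
  have hsB : (Real.sqrt B : ℂ) ≠ 0 := ofReal_ne_zero.2 (Real.sqrt_pos.2 hB).ne'
  have hs2 : (Real.sqrt 2 : ℂ) ≠ 0 := ofReal_ne_zero.2 (Real.sqrt_pos.2 two_pos).ne'
  have hsc : (Real.sqrt |c| : ℂ) ≠ 0 := ofReal_ne_zero.2 (Real.sqrt_pos.2 hc').ne'
  push_cast
  field_simp

/-- the slot map `π_t` (`inl i ↔ inr i` swapped exactly when `¬0 < t i`) is an involution. [cite: Shimura1997, §6] -/
theorem slot_involutive {l : Type*} (t : l → ℝ) :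
    Function.Involutive (Sum.elim (fun i => if 0 < t i then (Sum.inl i : l ⊕ l) else Sum.inr i) (fun i => if 0 < t i then (Sum.inr i : l ⊕ l) else Sum.inl i)) := by
  intro p
  rcases p with i | i <;> by_cases h : 0 < t i <;> simp [h]

end Elementary

/-! ## §2 The reading chart in the canonical sign frame, relabelled -/

section CM

open Literature.NumberTheory.Automorphic Literature.NumberTheory.Automorphic.UnitaryGroup Literature.NumberTheory.Weil1964
open Literature.NumberTheory.GelbartRogawski1991 Literature.NumberTheory.GelbartRogawski1991.UnitaryDualPair
open Literature.NumberTheory.GelbartRogawski1991.GRConstruction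
open Literature.RepresentationTheory.KonnoKonno2007 Literature.RepresentationTheory.KonnoKonno2007.RealDualPair
open Literature.Analysis.Matrix.KroneckerSum (exp_reindex)
open K2LiuArchSectionPlaceBlock

variable (L : Type) [Field L] [NumberField L] [IsCMField L] {N M n : ℕ} (e : Fin N × Fin M ≃ Fin n)
  (dV : Fin N → L) (hdV : ∀ i, IsCMField.complexConj L (dV i) = dV i)
  (dW : Fin M → L) (hdW : ∀ i, IsCMField.complexConj L (dW i) = dW i)

/-- **the Sylvester scaling of the doubled frame**: `D_σ k = √|x_σ k| = √(|t_{p̄}| ∕ |c_σ|)` for `k = e₂ p` (`x_σ(e₂ inl i) = t_i∕c_σ`, `x_σ(e₂ inr i) = −t_i∕c_σ`;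
★ `signVec_doubled_inl∕inr`, ★ FILE 3 `re_embedding_cmPlaceOver_eq`). [cite: HarrisKudlaSweet1996, §1 (1.9)] [cite: KonnoKonno2007, §3.1] -/
theorem sqrtAbs_signVec_doubled (σ : {v : InfinitePlace (Fp L) // v.IsReal}) (k : Fin (n + n)) :
    sqrtAbs (signVec (cmPlaceOver L) (fun k => Sum.elim (cmGramEntry L e dV hdV dW hdW) (-cmGramEntry L e dV hdV dW hdW) ((UnitaryDualPair.LocalSplitting.e₂ n).symm k)) (imagUnit L) σ) k =
      Real.sqrt (|((cmPlaceOver L σ).1.embedding (dV (e.symm (Sum.elim id id ((e₂ (n := n)).symm k))).1 * dW (e.symm (Sum.elim id id ((e₂ (n := n)).symm k))).2)).re| / |(deltaIm (cmPlaceOver L) (imagUnit L) σ)|) := by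
  have hx : ∀ i, signVec (cmPlaceOver L) (cmGramEntry L e dV hdV dW hdW) (imagUnit L) σ i = ((cmPlaceOver L σ).1.embedding (dV (e.symm i).1 * dW (e.symm i).2)).re / (deltaIm (cmPlaceOver L) (imagUnit L) σ) := fun i => by
    rw [K2LiuArchReadingFrameSign.re_embedding_cmPlaceOver_eq]; rfl
  obtain ⟨p, rfl⟩ := (e₂ (n := n)).surjective k
  rw [Equiv.symm_apply_apply]
  show Real.sqrt |(signVec (cmPlaceOver L) (fun k => Sum.elim (cmGramEntry L e dV hdV dW hdW) (-cmGramEntry L e dV hdV dW hdW) ((UnitaryDualPair.LocalSplitting.e₂ n).symm k)) (imagUnit L) σ) ((e₂ (n := n)) p)| = _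
  rcases p with i | i
  · rw [signVec_doubled_inl, hx, Sum.elim_inl, id, abs_div]
  · rw [signVec_doubled_inr, hx, Sum.elim_inr, id, abs_neg, abs_div]

variable (hdV0 : ∀ i, dV i ≠ 0) (hdW0 : ∀ j, dW j ≠ 0)

/-- the matrix of `relabel⁻¹ (toUFormEquiv_σ k)` is `((D_σ k D_σ⁻¹)^{ε_σ})^{eSp ⊕ eSq}` (★ `toUFormEquiv_apply`, ★ `coe_toUForm`, ★ `UForm.coe_relabel` read backwards).
[cite: PlatonovRapinchuk1994, §2.3] [cite: KonnoKonno2007, §3.1] -/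
theorem coe_relabel_symm_toUFormEquiv (σ : {v : InfinitePlace (Fp L) // v.IsReal}) (eSp : Fin n ≃ PosIdx (signVec (cmPlaceOver L) (fun k => Sum.elim (cmGramEntry L e dV hdV dW hdW) (-cmGramEntry L e dV hdV dW hdW) ((UnitaryDualPair.LocalSplitting.e₂ n).symm k)) (imagUnit L) σ)) (eSq : Fin n ≃ NegIdx (signVec (cmPlaceOver L) (fun k => Sum.elim (cmGramEntry L e dV hdV dW hdW) (-cmGramEntry L e dV hdV dW hdW) ((UnitaryDualPair.LocalSplitting.e₂ n).symm k)) (imagUnit L) σ))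
    (k : archLocal L (n + n) (hermD L e dV hdV dW hdW) (cmPlaceOver L σ)) :
    (((((UForm.relabel (Fin n) (Fin n) (PosIdx (signVec (cmPlaceOver L) (fun k => Sum.elim (cmGramEntry L e dV hdV dW hdW) (-cmGramEntry L e dV hdV dW hdW) ((UnitaryDualPair.LocalSplitting.e₂ n).symm k)) (imagUnit L) σ)) (NegIdx (signVec (cmPlaceOver L) (fun k => Sum.elim (cmGramEntry L e dV hdV dW hdW) (-cmGramEntry L e dV hdV dW hdW) ((UnitaryDualPair.LocalSplitting.e₂ n).symm k)) (imagUnit L) σ)) eSp eSq).symm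
        ((toUFormEquiv (signSplit (signVec (cmPlaceOver L) (fun k => Sum.elim (cmGramEntry L e dV hdV dW hdW) (-cmGramEntry L e dV hdV dW hdW) ((UnitaryDualPair.LocalSplitting.e₂ n).symm k)) (imagUnit L) σ))
          (sqrtAbs_signVec_ne_zero (IsCMField.complexConj_ne_one L) (cmPlaceOver_smul L) (complexConj_imagUnit L) (imagUnit_ne_zero L)
            (gramD_gram_realDiagonal_entry_ne_zero L e dV hdV dW hdW hdV0 hdW0) σ)
          (deltaIm_ne_zero (IsCMField.complexConj_ne_one L) (cmPlaceOver_smul L) (complexConj_imagUnit L) (imagUnit_ne_zero L) σ)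
          (formCongr_signFrame_eq L (IsCMField.complexConj L) (n + n) (IsCMField.complexConj_ne_one L) (cmPlaceOver L) (cmPlaceOver_smul L) _
            (gramD_gram_realDiagonal_entry_ne_zero L e dV hdV dW hdW hdV0 hdW0) (complexConj_imagUnit L) (imagUnit_ne_zero L) σ (cmPlaceOver_comap L)
            (gramD_eq_diagonal_cm L e dV hdV dW hdW) (J := hermD L e dV hdV dW hdW) rfl)) k)) : UForm (Fin n) (Fin n)) : GL (Fin n ⊕ Fin n) ℂ) : Matrix (Fin n ⊕ Fin n) (Fin n ⊕ Fin n) ℂ) =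
      (Matrix.reindex (signSplit (signVec (cmPlaceOver L) (fun k => Sum.elim (cmGramEntry L e dV hdV dW hdW) (-cmGramEntry L e dV hdV dW hdW) ((UnitaryDualPair.LocalSplitting.e₂ n).symm k)) (imagUnit L) σ)) (signSplit (signVec (cmPlaceOver L) (fun k => Sum.elim (cmGramEntry L e dV hdV dW hdW) (-cmGramEntry L e dV hdV dW hdW) ((UnitaryDualPair.LocalSplitting.e₂ n).symm k)) (imagUnit L) σ))
        (scaleConj (sqrtAbs (signVec (cmPlaceOver L) (fun k => Sum.elim (cmGramEntry L e dV hdV dW hdW) (-cmGramEntry L e dV hdV dW hdW) ((UnitaryDualPair.LocalSplitting.e₂ n).symm k)) (imagUnit L) σ))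
          (((k : archLocal L (n + n) (hermD L e dV hdV dW hdW) (cmPlaceOver L σ)) : GL (Fin (n + n)) ℂ) : Matrix (Fin (n + n)) (Fin (n + n)) ℂ))).submatrix
        (Equiv.sumCongr eSp eSq) (Equiv.sumCongr eSp eSq) := by
  have h := UForm.coe_relabel eSp eSq ((UForm.relabel (Fin n) (Fin n) (PosIdx (signVec (cmPlaceOver L) (fun k => Sum.elim (cmGramEntry L e dV hdV dW hdW) (-cmGramEntry L e dV hdV dW hdW) ((UnitaryDualPair.LocalSplitting.e₂ n).symm k)) (imagUnit L) σ)) (NegIdx (signVec (cmPlaceOver L) (fun k => Sum.elim (cmGramEntry L e dV hdV dW hdW) (-cmGramEntry L e dV hdV dW hdW) ((UnitaryDualPair.LocalSplitting.e₂ n).symm k)) (imagUnit L) σ)) eSp eSq).symm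
    ((toUFormEquiv (signSplit (signVec (cmPlaceOver L) (fun k => Sum.elim (cmGramEntry L e dV hdV dW hdW) (-cmGramEntry L e dV hdV dW hdW) ((UnitaryDualPair.LocalSplitting.e₂ n).symm k)) (imagUnit L) σ))
          (sqrtAbs_signVec_ne_zero (IsCMField.complexConj_ne_one L) (cmPlaceOver_smul L) (complexConj_imagUnit L) (imagUnit_ne_zero L)
            (gramD_gram_realDiagonal_entry_ne_zero L e dV hdV dW hdW hdV0 hdW0) σ)
          (deltaIm_ne_zero (IsCMField.complexConj_ne_one L) (cmPlaceOver_smul L) (complexConj_imagUnit L) (imagUnit_ne_zero L) σ)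
          (formCongr_signFrame_eq L (IsCMField.complexConj L) (n + n) (IsCMField.complexConj_ne_one L) (cmPlaceOver L) (cmPlaceOver_smul L) _
            (gramD_gram_realDiagonal_entry_ne_zero L e dV hdV dW hdW hdV0 hdW0) (complexConj_imagUnit L) (imagUnit_ne_zero L) σ (cmPlaceOver_comap L)
            (gramD_eq_diagonal_cm L e dV hdV dW hdW) (J := hermD L e dV hdV dW hdW) rfl)) k))
  rw [ContinuousMulEquiv.apply_symm_apply] at h
  -- `relabel⁻¹` in matrices (★ `UForm.coe_relabel` read backwards)
  have h2 : (((((UForm.relabel (Fin n) (Fin n) (PosIdx (signVec (cmPlaceOver L) (fun k => Sum.elim (cmGramEntry L e dV hdV dW hdW) (-cmGramEntry L e dV hdV dW hdW) ((UnitaryDualPair.LocalSplitting.e₂ n).symm k)) (imagUnit L) σ)) (NegIdx (signVec (cmPlaceOver L) (fun k => Sum.elim (cmGramEntry L e dV hdV dW hdW) (-cmGramEntry L e dV hdV dW hdW) ((UnitaryDualPair.LocalSplitting.e₂ n).symm k)) (imagUnit L) σ)) eSp eSq).symm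
      ((toUFormEquiv (signSplit (signVec (cmPlaceOver L) (fun k => Sum.elim (cmGramEntry L e dV hdV dW hdW) (-cmGramEntry L e dV hdV dW hdW) ((UnitaryDualPair.LocalSplitting.e₂ n).symm k)) (imagUnit L) σ))
          (sqrtAbs_signVec_ne_zero (IsCMField.complexConj_ne_one L) (cmPlaceOver_smul L) (complexConj_imagUnit L) (imagUnit_ne_zero L)
            (gramD_gram_realDiagonal_entry_ne_zero L e dV hdV dW hdW hdV0 hdW0) σ)
          (deltaIm_ne_zero (IsCMField.complexConj_ne_one L) (cmPlaceOver_smul L) (complexConj_imagUnit L) (imagUnit_ne_zero L) σ)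
          (formCongr_signFrame_eq L (IsCMField.complexConj L) (n + n) (IsCMField.complexConj_ne_one L) (cmPlaceOver L) (cmPlaceOver_smul L) _
            (gramD_gram_realDiagonal_entry_ne_zero L e dV hdV dW hdW hdV0 hdW0) (complexConj_imagUnit L) (imagUnit_ne_zero L) σ (cmPlaceOver_comap L)
            (gramD_eq_diagonal_cm L e dV hdV dW hdW) (J := hermD L e dV hdV dW hdW) rfl)) k)) : UForm (Fin n) (Fin n)) : GL (Fin n ⊕ Fin n) ℂ) : Matrix (Fin n ⊕ Fin n) (Fin n ⊕ Fin n) ℂ) =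
      (((((toUFormEquiv (signSplit (signVec (cmPlaceOver L) (fun k => Sum.elim (cmGramEntry L e dV hdV dW hdW) (-cmGramEntry L e dV hdV dW hdW) ((UnitaryDualPair.LocalSplitting.e₂ n).symm k)) (imagUnit L) σ))
          (sqrtAbs_signVec_ne_zero (IsCMField.complexConj_ne_one L) (cmPlaceOver_smul L) (complexConj_imagUnit L) (imagUnit_ne_zero L)
            (gramD_gram_realDiagonal_entry_ne_zero L e dV hdV dW hdW hdV0 hdW0) σ)
          (deltaIm_ne_zero (IsCMField.complexConj_ne_one L) (cmPlaceOver_smul L) (complexConj_imagUnit L) (imagUnit_ne_zero L) σ)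
          (formCongr_signFrame_eq L (IsCMField.complexConj L) (n + n) (IsCMField.complexConj_ne_one L) (cmPlaceOver L) (cmPlaceOver_smul L) _
            (gramD_gram_realDiagonal_entry_ne_zero L e dV hdV dW hdW hdV0 hdW0) (complexConj_imagUnit L) (imagUnit_ne_zero L) σ (cmPlaceOver_comap L)
            (gramD_eq_diagonal_cm L e dV hdV dW hdW) (J := hermD L e dV hdV dW hdW) rfl)) k) :
        UForm (PosIdx (signVec (cmPlaceOver L) (fun k => Sum.elim (cmGramEntry L e dV hdV dW hdW) (-cmGramEntry L e dV hdV dW hdW) ((UnitaryDualPair.LocalSplitting.e₂ n).symm k)) (imagUnit L) σ)) (NegIdx (signVec (cmPlaceOver L) (fun k => Sum.elim (cmGramEntry L e dV hdV dW hdW) (-cmGramEntry L e dV hdV dW hdW) ((UnitaryDualPair.LocalSplitting.e₂ n).symm k)) (imagUnit L) σ))) : GL (PosIdx (signVec (cmPlaceOver L) (fun k => Sum.elim (cmGramEntry L e dV hdV dW hdW) (-cmGramEntry L e dV hdV dW hdW) ((UnitaryDualPair.LocalSplitting.e₂ n).symm k)) (imagUnit L) σ) ⊕ NegIdx (signVec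 (cmPlaceOver L) (fun k => Sum.elim (cmGramEntry L e dV hdV dW hdW) (-cmGramEntry L e dV hdV dW hdW) ((UnitaryDualPair.LocalSplitting.e₂ n).symm k)) (imagUnit L) σ)) ℂ) : Matrix _ _ ℂ).submatrix (Equiv.sumCongr eSp eSq) (Equiv.sumCongr eSp eSq) := by
    rw [h, reindex_apply, submatrix_submatrix, Equiv.symm_comp_self, submatrix_id_id]
  rw [h2, toUFormEquiv_apply, coe_toUForm]

/-- **THE READING CHART IN THE SIGN FRAME IS A COORDINATE PERMUTATION OF THE DIAGONAL PICTURE**: for `P = C M C′ ∈ U(J)(ℂ)` the matrix of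
`relabel⁻¹ (toUFormEquiv_σ (ι_{w(σ)} P))` is `M ∘ (θ × θ)`, `θ = π_t ∘ e₂⁻¹ ∘ ε_σ⁻¹ ∘ (eSp ⊕ eSq)` — ★ FILE 4's matrix formula `hιM`, ★ FILE 5 `frameInv_cayley_conj_frame`
(`T⁻¹ (C M C′) T = (d_p⁻¹ M_{πp,πq} d_q)`), and the cancellation `D_σ(e₂p) d_p⁻¹ · d_q D_σ(e₂q)⁻¹ = 1` (§1, `sqrtAbs_signVec_doubled`).
[cite: Shimura1997, §6] [cite: Knapp1986, Ch. VI §2] [cite: KonnoKonno2007, §3.1] -/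
theorem coe_relabel_symm_toUFormEquiv_readingChart (σ : {v : InfinitePlace (Fp L) // v.IsReal})
    (ι : Matrix (Fin n ⊕ Fin n) (Fin n ⊕ Fin n) ℂ → archLocal L (n + n) (hermD L e dV hdV dW hdW) (cmPlaceOver L σ))
    (hιM : ∀ P : Matrix (Fin n ⊕ Fin n) (Fin n ⊕ Fin n) ℂ, Pᴴ * Matrix.J (Fin n) ℂ * P = Matrix.J (Fin n) ℂ →
      ((((ι P : archLocal L (n + n) (hermD L e dV hdV dW hdW) (cmPlaceOver L σ)) : GL (Fin (n + n)) ℂ)) : Matrix (Fin (n + n)) (Fin (n + n)) ℂ) =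
        Matrix.reindex (e₂ (n := n)) (e₂ (n := n))
          (fromBlocks (diagonal (fun k => (((Real.sqrt (|((cmPlaceOver L σ).1.embedding (dV (e.symm k).1 * dW (e.symm k).2)).re| / 2))⁻¹ / 2 : ℝ) : ℂ)))
              (-diagonal (fun k => I * (((Real.sqrt (|((cmPlaceOver L σ).1.embedding (dV (e.symm k).1 * dW (e.symm k).2)).re| / 2))⁻¹ *
                (((cmPlaceOver L σ).1.embedding (dV (e.symm k).1 * dW (e.symm k).2)).re / |((cmPlaceOver L σ).1.embedding (dV (e.symm k).1 * dW (e.symm k).2)).re|) / 2 : ℝ) : ℂ)))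
              (diagonal (fun k => (((Real.sqrt (|((cmPlaceOver L σ).1.embedding (dV (e.symm k).1 * dW (e.symm k).2)).re| / 2))⁻¹ / 2 : ℝ) : ℂ)))
              (diagonal (fun k => I * (((Real.sqrt (|((cmPlaceOver L σ).1.embedding (dV (e.symm k).1 * dW (e.symm k).2)).re| / 2))⁻¹ *
                (((cmPlaceOver L σ).1.embedding (dV (e.symm k).1 * dW (e.symm k).2)).re / |((cmPlaceOver L σ).1.embedding (dV (e.symm k).1 * dW (e.symm k).2)).re|) / 2 : ℝ) : ℂ))) * P *
            fromBlocks (diagonal (fun k => (Real.sqrt (|((cmPlaceOver L σ).1.embedding (dV (e.symm k).1 * dW (e.symm k).2)).re| / 2) : ℂ)))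
              (diagonal (fun k => (Real.sqrt (|((cmPlaceOver L σ).1.embedding (dV (e.symm k).1 * dW (e.symm k).2)).re| / 2) : ℂ)))
              (diagonal (fun k => I * (((((cmPlaceOver L σ).1.embedding (dV (e.symm k).1 * dW (e.symm k).2)).re / |((cmPlaceOver L σ).1.embedding (dV (e.symm k).1 * dW (e.symm k).2)).re|) *
                Real.sqrt (|((cmPlaceOver L σ).1.embedding (dV (e.symm k).1 * dW (e.symm k).2)).re| / 2) : ℝ) : ℂ)))
              (-diagonal (fun k => I * (((((cmPlaceOver L σ).1.embedding (dV (e.symm k).1 * dW (e.symm k).2)).re / |((cmPlaceOver L σ).1.embedding (dV (e.symm k).1 * dW (e.symm k).2)).re|) *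
                Real.sqrt (|((cmPlaceOver L σ).1.embedding (dV (e.symm k).1 * dW (e.symm k).2)).re| / 2) : ℝ) : ℂ)))))
    (eSp : Fin n ≃ PosIdx (signVec (cmPlaceOver L) (fun k => Sum.elim (cmGramEntry L e dV hdV dW hdW) (-cmGramEntry L e dV hdV dW hdW) ((UnitaryDualPair.LocalSplitting.e₂ n).symm k)) (imagUnit L) σ)) (eSq : Fin n ≃ NegIdx (signVec (cmPlaceOver L) (fun k => Sum.elim (cmGramEntry L e dV hdV dW hdW) (-cmGramEntry L e dV hdV dW hdW) ((UnitaryDualPair.LocalSplitting.e₂ n).symm k)) (imagUnit L) σ))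
    (M : Matrix (Fin n ⊕ Fin n) (Fin n ⊕ Fin n) ℂ)
    (hM : ((fromBlocks 1 1 (I • 1) (-(I • 1)) : Matrix (Fin n ⊕ Fin n) (Fin n ⊕ Fin n) ℂ) * M * ((2 : ℂ)⁻¹ • fromBlocks 1 (-(I • 1)) 1 (I • 1)))ᴴ * Matrix.J (Fin n) ℂ * ((fromBlocks 1 1 (I • 1) (-(I • 1)) : Matrix (Fin n ⊕ Fin n) (Fin n ⊕ Fin n) ℂ) * M * ((2 : ℂ)⁻¹ • fromBlocks 1 (-(I • 1)) 1 (I • 1))) = Matrix.J (Fin n) ℂ) :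
    (((((UForm.relabel (Fin n) (Fin n) (PosIdx (signVec (cmPlaceOver L) (fun k => Sum.elim (cmGramEntry L e dV hdV dW hdW) (-cmGramEntry L e dV hdV dW hdW) ((UnitaryDualPair.LocalSplitting.e₂ n).symm k)) (imagUnit L) σ)) (NegIdx (signVec (cmPlaceOver L) (fun k => Sum.elim (cmGramEntry L e dV hdV dW hdW) (-cmGramEntry L e dV hdV dW hdW) ((UnitaryDualPair.LocalSplitting.e₂ n).symm k)) (imagUnit L) σ)) eSp eSq).symm
        ((toUFormEquiv (signSplit (signVec (cmPlaceOver L) (fun k => Sum.elim (cmGramEntry L e dV hdV dW hdW) (-cmGramEntry L e dV hdV dW hdW) ((UnitaryDualPair.LocalSplitting.e₂ n).symm k)) (imagUnit L) σ))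
          (sqrtAbs_signVec_ne_zero (IsCMField.complexConj_ne_one L) (cmPlaceOver_smul L) (complexConj_imagUnit L) (imagUnit_ne_zero L)
            (gramD_gram_realDiagonal_entry_ne_zero L e dV hdV dW hdW hdV0 hdW0) σ)
          (deltaIm_ne_zero (IsCMField.complexConj_ne_one L) (cmPlaceOver_smul L) (complexConj_imagUnit L) (imagUnit_ne_zero L) σ)
          (formCongr_signFrame_eq L (IsCMField.complexConj L) (n + n) (IsCMField.complexConj_ne_one L) (cmPlaceOver L) (cmPlaceOver_smul L) _
            (gramD_gram_realDiagonal_entry_ne_zero L e dV hdV dW hdW hdV0 hdW0) (complexConj_imagUnit L) (imagUnit_ne_zero L) σ (cmPlaceOver_comap L)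
            (gramD_eq_diagonal_cm L e dV hdV dW hdW) (J := hermD L e dV hdV dW hdW) rfl))
          (ι ((fromBlocks 1 1 (I • 1) (-(I • 1)) : Matrix (Fin n ⊕ Fin n) (Fin n ⊕ Fin n) ℂ) * M * ((2 : ℂ)⁻¹ • fromBlocks 1 (-(I • 1)) 1 (I • 1)))))) : UForm (Fin n) (Fin n)) : GL (Fin n ⊕ Fin n) ℂ) : Matrix (Fin n ⊕ Fin n) (Fin n ⊕ Fin n) ℂ) =
      M.submatrix (fun i : Fin n ⊕ Fin n => Sum.elim (fun k => if 0 < ((cmPlaceOver L σ).1.embedding (dV (e.symm k).1 * dW (e.symm k).2)).re then (Sum.inl k : Fin n ⊕ Fin n) else Sum.inr k) (fun k => if 0 < ((cmPlaceOver L σ).1.embedding (dV (e.symm k).1 * dW (e.symm k).2)).re then (Sum.inr k : Fin n ⊕ Fin n) else Sum.inl k) ((e₂ (n := n)).symm (((signSplit (signVec (cmPlaceOver L) (fun k => Sum.elim (cmGramEntry L e dV hdV dW hdW) (-cmGramEntry L e dV hdV dW hdW) ((UnitaryDualPair.LocalSplitting.e₂ n).symm k)) (imagUnit L) σ)).symm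 (Equiv.sumCongr eSp eSq i)) : Fin (n + n))))
        (fun i : Fin n ⊕ Fin n => Sum.elim (fun k => if 0 < ((cmPlaceOver L σ).1.embedding (dV (e.symm k).1 * dW (e.symm k).2)).re then (Sum.inl k : Fin n ⊕ Fin n) else Sum.inr k) (fun k => if 0 < ((cmPlaceOver L σ).1.embedding (dV (e.symm k).1 * dW (e.symm k).2)).re then (Sum.inr k : Fin n ⊕ Fin n) else Sum.inl k) ((e₂ (n := n)).symm (((signSplit (signVec (cmPlaceOver L) (fun k => Sum.elim (cmGramEntry L e dV hdV dW hdW) (-cmGramEntry L e dV hdV dW hdW) ((UnitaryDualPair.LocalSplitting.e₂ n).symm k)) (imagUnit L) σ)).symm (Equiv.sumCongr eSp eSq i)) : Fin (n + n)))) := by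
  have ht : ∀ k, ((cmPlaceOver L σ).1.embedding (dV (e.symm k).1 * dW (e.symm k).2)).re ≠ 0 := fun k =>
    K2LiuHermitianTubeFrameArch.tw_ne_zero L e dV hdV dW hdW (cmPlaceOver L σ) (cmPlaceOver_smul L σ) hdV0 hdW0 k
  have hc : (deltaIm (cmPlaceOver L) (imagUnit L) σ) ≠ 0 :=
    deltaIm_ne_zero (IsCMField.complexConj_ne_one L) (cmPlaceOver_smul L) (complexConj_imagUnit L) (imagUnit_ne_zero L) σ
  rw [coe_relabel_symm_toUFormEquiv L e dV hdV dW hdW hdV0 hdW0 σ eSp eSq, hιM _ hM,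
    K2LiuArchReadingChartPlaceSec.frameInv_cayley_conj_frame (fun k => ((cmPlaceOver L σ).1.embedding (dV (e.symm k).1 * dW (e.symm k).2)).re) ht M]
  ext i j
  rw [submatrix_apply, reindex_apply, submatrix_apply, scaleConj_apply, reindex_apply, submatrix_apply, Matrix.of_apply, submatrix_apply,
    sqrtAbs_signVec_doubled, sqrtAbs_signVec_doubled]
  exact sqrt_cancel _ _ _ (abs_pos.2 (ht _)) (abs_pos.2 (ht _)) hc _

/-! ## §3 The letter (F2′): the exponential curves of the reading chart are `ψ (exp (sY′))` -/

/-- **(F2′) — THE `hιψ` LETTER OF ★ `hcurve_of_frame`** (`w := cmPlaceOver L σ`, `ψ := placeSec_𝔻 σ ∘ UForm.relabel eSp eSq`, ANY block identification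
`eSp : Fin n ≃ 𝔻⁺_σ`, `eSq : Fin n ≃ 𝔻⁻_σ`).  For `X = C A C′` with `Xᴴ J + J X = 0` put `Y′ := A ∘ (θ × θ)`; then `Y′ ∈ 𝔲(n,n)` — every `exp (tY′)` is the matrix of
the `U(n,n)`-element `relabel⁻¹ (toUFormEquiv_σ (ι (exp tX)))` (§2 with `M = exp (tA)`, ★ `exp_smul_cayley_conj`, ★ `exp_reindex`, ★ `conjTranspose_exp_mul_J_mul_exp`;
★ `uFormGroup_regular`) — and **`archPiEquivCM⁻¹ (mulSingle w(σ) (ι (exp (sX)))) = ψ (expMem (s • Y′))` for all real `s`** (★ `placeSec_apply`, ★ `archSingle_apply`).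
[cite: Knapp1986, Ch. VI §2] [cite: Shimura1997, §6] [cite: KonnoKonno2007, §3.1] [cite: BorelJacquet1979, §4.1] -/
theorem exists_lie_exp_readingChart_eq_placeSec_relabel (σ : {v : InfinitePlace (Fp L) // v.IsReal})
    (ι : Matrix (Fin n ⊕ Fin n) (Fin n ⊕ Fin n) ℂ → archLocal L (n + n) (hermD L e dV hdV dW hdW) (cmPlaceOver L σ))
    (hιM : ∀ P : Matrix (Fin n ⊕ Fin n) (Fin n ⊕ Fin n) ℂ, Pᴴ * Matrix.J (Fin n) ℂ * P = Matrix.J (Fin n) ℂ →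
      ((((ι P : archLocal L (n + n) (hermD L e dV hdV dW hdW) (cmPlaceOver L σ)) : GL (Fin (n + n)) ℂ)) : Matrix (Fin (n + n)) (Fin (n + n)) ℂ) =
        Matrix.reindex (e₂ (n := n)) (e₂ (n := n))
          (fromBlocks (diagonal (fun k => (((Real.sqrt (|((cmPlaceOver L σ).1.embedding (dV (e.symm k).1 * dW (e.symm k).2)).re| / 2))⁻¹ / 2 : ℝ) : ℂ)))
              (-diagonal (fun k => I * (((Real.sqrt (|((cmPlaceOver L σ).1.embedding (dV (e.symm k).1 * dW (e.symm k).2)).re| / 2))⁻¹ *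
                (((cmPlaceOver L σ).1.embedding (dV (e.symm k).1 * dW (e.symm k).2)).re / |((cmPlaceOver L σ).1.embedding (dV (e.symm k).1 * dW (e.symm k).2)).re|) / 2 : ℝ) : ℂ)))
              (diagonal (fun k => (((Real.sqrt (|((cmPlaceOver L σ).1.embedding (dV (e.symm k).1 * dW (e.symm k).2)).re| / 2))⁻¹ / 2 : ℝ) : ℂ)))
              (diagonal (fun k => I * (((Real.sqrt (|((cmPlaceOver L σ).1.embedding (dV (e.symm k).1 * dW (e.symm k).2)).re| / 2))⁻¹ *
                (((cmPlaceOver L σ).1.embedding (dV (e.symm k).1 * dW (e.symm k).2)).re / |((cmPlaceOver L σ).1.embedding (dV (e.symm k).1 * dW (e.symm k).2)).re|) / 2 : ℝ) : ℂ))) * P *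
            fromBlocks (diagonal (fun k => (Real.sqrt (|((cmPlaceOver L σ).1.embedding (dV (e.symm k).1 * dW (e.symm k).2)).re| / 2) : ℂ)))
              (diagonal (fun k => (Real.sqrt (|((cmPlaceOver L σ).1.embedding (dV (e.symm k).1 * dW (e.symm k).2)).re| / 2) : ℂ)))
              (diagonal (fun k => I * (((((cmPlaceOver L σ).1.embedding (dV (e.symm k).1 * dW (e.symm k).2)).re / |((cmPlaceOver L σ).1.embedding (dV (e.symm k).1 * dW (e.symm k).2)).re|) *
                Real.sqrt (|((cmPlaceOver L σ).1.embedding (dV (e.symm k).1 * dW (e.symm k).2)).re| / 2) : ℝ) : ℂ)))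
              (-diagonal (fun k => I * (((((cmPlaceOver L σ).1.embedding (dV (e.symm k).1 * dW (e.symm k).2)).re / |((cmPlaceOver L σ).1.embedding (dV (e.symm k).1 * dW (e.symm k).2)).re|) *
                Real.sqrt (|((cmPlaceOver L σ).1.embedding (dV (e.symm k).1 * dW (e.symm k).2)).re| / 2) : ℝ) : ℂ)))))
    (eSp : Fin n ≃ PosIdx (signVec (cmPlaceOver L) (fun k => Sum.elim (cmGramEntry L e dV hdV dW hdW) (-cmGramEntry L e dV hdV dW hdW) ((UnitaryDualPair.LocalSplitting.e₂ n).symm k)) (imagUnit L) σ)) (eSq : Fin n ≃ NegIdx (signVec (cmPlaceOver L) (fun k => Sum.elim (cmGramEntry L e dV hdV dW hdW) (-cmGramEntry L e dV hdV dW hdW) ((UnitaryDualPair.LocalSplitting.e₂ n).symm k)) (imagUnit L) σ))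
    (A : Matrix (Fin n ⊕ Fin n) (Fin n ⊕ Fin n) ℂ)
    (hX : (fromBlocks 1 1 (I • 1) (-(I • 1)) * A * ((2 : ℂ)⁻¹ • fromBlocks 1 (-(I • 1)) 1 (I • 1)) : Matrix (Fin n ⊕ Fin n) (Fin n ⊕ Fin n) ℂ)ᴴ * Matrix.J (Fin n) ℂ +
      Matrix.J (Fin n) ℂ * (fromBlocks 1 1 (I • 1) (-(I • 1)) * A * ((2 : ℂ)⁻¹ • fromBlocks 1 (-(I • 1)) 1 (I • 1)) : Matrix (Fin n ⊕ Fin n) (Fin n ⊕ Fin n) ℂ) = 0) :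
    ∃ Y' : ↥(uFormGroup (Fin n) (Fin n)).lie.toSubmodule, ∀ s : ℝ,
      (UnitaryGroup.archPiEquivCM (n + n) L (hermD L e dV hdV dW hdW)).symm
          (Pi.mulSingle (cmPlaceOver L σ) (ι (NormedSpace.exp (s • (fromBlocks 1 1 (I • 1) (-(I • 1)) * A * ((2 : ℂ)⁻¹ • fromBlocks 1 (-(I • 1)) 1 (I • 1)) : Matrix (Fin n ⊕ Fin n) (Fin n ⊕ Fin n) ℂ))))) =
        ((placeSec L (IsCMField.complexConj L) (n + n) (IsCMField.complexConj_ne_one L) (cmPlaceOver L) (cmPlaceOver_smul L) _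
            (gramD_gram_realDiagonal_entry_ne_zero L e dV hdV dW hdW hdV0 hdW0) (complexConj_imagUnit L) (imagUnit_ne_zero L) σ
            (cmPlaceOver_comap L) (gramD_eq_diagonal_cm L e dV hdV dW hdW) (J := hermD L e dV hdV dW hdW) rfl
            (complexConj_smul_infinitePlace L)).comp
          (UForm.relabel (Fin n) (Fin n) (PosIdx (signVec (cmPlaceOver L) (fun k => Sum.elim (cmGramEntry L e dV hdV dW hdW) (-cmGramEntry L e dV hdV dW hdW) ((UnitaryDualPair.LocalSplitting.e₂ n).symm k)) (imagUnit L) σ)) (NegIdx (signVec (cmPlaceOver L) (fun k => Sum.elim (cmGramEntry L e dV hdV dW hdW) (-cmGramEntry L e dV hdV dW hdW) ((UnitaryDualPair.LocalSplitting.e₂ n).symm k)) (imagUnit L) σ)) eSp eSq).toMonoidHom)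
          ((uFormGroup (Fin n) (Fin n)).expMem ⟨((s • Y' : ↥(uFormGroup (Fin n) (Fin n)).lie.toSubmodule) : Matrix (Fin n ⊕ Fin n) (Fin n ⊕ Fin n) ℂ), (s • Y').2⟩ :
            UForm (Fin n) (Fin n)) := by
  -- the coordinate permutation `θ` as an equivalence
  obtain ⟨θ, hθ⟩ : ∃ θ : Fin n ⊕ Fin n ≃ Fin n ⊕ Fin n, ∀ i, θ i = (fun i : Fin n ⊕ Fin n => Sum.elim (fun k => if 0 < ((cmPlaceOver L σ).1.embedding (dV (e.symm k).1 * dW (e.symm k).2)).re then (Sum.inl k : Fin n ⊕ Fin n) else Sum.inr k) (fun k => if 0 < ((cmPlaceOver L σ).1.embedding (dV (e.symm k).1 * dW (e.symm k).2)).re then (Sum.inr k : Fin n ⊕ Fin n) else Sum.inl k) ((e₂ (n := n)).symm (((signSplit (signVec (cmPlaceOver L) (fun k => Sum.elim (cmGramEntry L e dV hdV dW hdW) (-cmGramEntry L e dV hdV dW hdW) ((UnitaryDualPair.LocalSplitting.e₂ n).symm k)) (imagUnit L) σ)).symm (Equiv.sumCongr eSp eSq i)) : Fin (n + n)))) i 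:=
    ⟨(Equiv.sumCongr eSp eSq).trans ((signSplit (signVec (cmPlaceOver L) (fun k => Sum.elim (cmGramEntry L e dV hdV dW hdW) (-cmGramEntry L e dV hdV dW hdW) ((UnitaryDualPair.LocalSplitting.e₂ n).symm k)) (imagUnit L) σ)).symm.trans
      ((e₂ (n := n)).symm.trans ((slot_involutive (fun k => ((cmPlaceOver L σ).1.embedding (dV (e.symm k).1 * dW (e.symm k).2)).re)).toPerm _))), fun i => rfl⟩
  have hθf : (fun i : Fin n ⊕ Fin n => Sum.elim (fun k => if 0 < ((cmPlaceOver L σ).1.embedding (dV (e.symm k).1 * dW (e.symm k).2)).re then (Sum.inl k : Fin n ⊕ Fin n) else Sum.inr k) (fun k => if 0 < ((cmPlaceOver L σ).1.embedding (dV (e.symm k).1 * dW (e.symm k).2)).re then (Sum.inr k : Fin n ⊕ Fin n) else Sum.inl k) ((e₂ (n := n)).symm (((signSplit (signVec (cmPlaceOver L) (fun k => Sum.elim (cmGramEntry L e dV hdV dW hdW) (-cmGramEntry L e dV hdV dW hdW) ((UnitaryDualPair.LocalSplitting.e₂ n).symm k)) (imagUnit L) σ)).symm (Equiv.sumCongr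 eSp eSq i)) : Fin (n + n)))) = ⇑θ :=
    funext fun i => (hθ i).symm
  -- the matrices of the chart values along the curve: `exp (s • (A ∘ (θ × θ)))`
  have hmat : ∀ s : ℝ, (((((UForm.relabel (Fin n) (Fin n) (PosIdx (signVec (cmPlaceOver L) (fun k => Sum.elim (cmGramEntry L e dV hdV dW hdW) (-cmGramEntry L e dV hdV dW hdW) ((UnitaryDualPair.LocalSplitting.e₂ n).symm k)) (imagUnit L) σ)) (NegIdx (signVec (cmPlaceOver L) (fun k => Sum.elim (cmGramEntry L e dV hdV dW hdW) (-cmGramEntry L e dV hdV dW hdW) ((UnitaryDualPair.LocalSplitting.e₂ n).symm k)) (imagUnit L) σ)) eSp eSq).symm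
      ((toUFormEquiv (signSplit (signVec (cmPlaceOver L) (fun k => Sum.elim (cmGramEntry L e dV hdV dW hdW) (-cmGramEntry L e dV hdV dW hdW) ((UnitaryDualPair.LocalSplitting.e₂ n).symm k)) (imagUnit L) σ))
          (sqrtAbs_signVec_ne_zero (IsCMField.complexConj_ne_one L) (cmPlaceOver_smul L) (complexConj_imagUnit L) (imagUnit_ne_zero L)
            (gramD_gram_realDiagonal_entry_ne_zero L e dV hdV dW hdW hdV0 hdW0) σ)
          (deltaIm_ne_zero (IsCMField.complexConj_ne_one L) (cmPlaceOver_smul L) (complexConj_imagUnit L) (imagUnit_ne_zero L) σ)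
          (formCongr_signFrame_eq L (IsCMField.complexConj L) (n + n) (IsCMField.complexConj_ne_one L) (cmPlaceOver L) (cmPlaceOver_smul L) _
            (gramD_gram_realDiagonal_entry_ne_zero L e dV hdV dW hdW hdV0 hdW0) (complexConj_imagUnit L) (imagUnit_ne_zero L) σ (cmPlaceOver_comap L)
            (gramD_eq_diagonal_cm L e dV hdV dW hdW) (J := hermD L e dV hdV dW hdW) rfl))
        (ι (NormedSpace.exp (s • (fromBlocks 1 1 (I • 1) (-(I • 1)) * A * ((2 : ℂ)⁻¹ • fromBlocks 1 (-(I • 1)) 1 (I • 1)) : Matrix (Fin n ⊕ Fin n) (Fin n ⊕ Fin n) ℂ)))))) : UForm (Fin n) (Fin n)) : GL (Fin n ⊕ Fin n) ℂ) : Matrix (Fin n ⊕ Fin n) (Fin n ⊕ Fin n) ℂ) =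
      NormedSpace.exp (s • A.submatrix θ θ) := fun s => by
    have hP : ((fromBlocks 1 1 (I • 1) (-(I • 1)) : Matrix (Fin n ⊕ Fin n) (Fin n ⊕ Fin n) ℂ) * (NormedSpace.exp (s • A)) * ((2 : ℂ)⁻¹ • fromBlocks 1 (-(I • 1)) 1 (I • 1)))ᴴ * Matrix.J (Fin n) ℂ *
        ((fromBlocks 1 1 (I • 1) (-(I • 1)) : Matrix (Fin n ⊕ Fin n) (Fin n ⊕ Fin n) ℂ) * (NormedSpace.exp (s • A)) * ((2 : ℂ)⁻¹ • fromBlocks 1 (-(I • 1)) 1 (I • 1))) = Matrix.J (Fin n) ℂ := by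
      rw [← K2LiuArchTubeCurveAlgebra.exp_smul_cayley_conj]
      exact K2LiuLieRayDifferentiability.conjTranspose_exp_mul_J_mul_exp hX s
    rw [K2LiuArchTubeCurveAlgebra.exp_smul_cayley_conj s A,
      coe_relabel_symm_toUFormEquiv_readingChart L e dV hdV dW hdW hdV0 hdW0 σ ι hιM eSp eSq (NormedSpace.exp (s • A)) hP, hθf,
      show s • A.submatrix θ θ = Matrix.reindex θ.symm θ.symm (s • A) by rw [reindex_apply, Equiv.symm_symm]; rfl, exp_reindex, reindex_apply,
      Equiv.symm_symm]
  -- `Y′ := A ∘ (θ × θ)` is a Lie element: all its exponentials are chart values (★ `uFormGroup_regular`)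
  have hmem : A.submatrix θ θ ∈ (uFormGroup (Fin n) (Fin n)).lie := by
    refine uFormGroup_regular _ fun t => ?_
    have hg := coe_mem_uFormGroup_carrier ((UForm.relabel (Fin n) (Fin n) (PosIdx (signVec (cmPlaceOver L) (fun k => Sum.elim (cmGramEntry L e dV hdV dW hdW) (-cmGramEntry L e dV hdV dW hdW) ((UnitaryDualPair.LocalSplitting.e₂ n).symm k)) (imagUnit L) σ)) (NegIdx (signVec (cmPlaceOver L) (fun k => Sum.elim (cmGramEntry L e dV hdV dW hdW) (-cmGramEntry L e dV hdV dW hdW) ((UnitaryDualPair.LocalSplitting.e₂ n).symm k)) (imagUnit L) σ)) eSp eSq).symm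
      ((toUFormEquiv (signSplit (signVec (cmPlaceOver L) (fun k => Sum.elim (cmGramEntry L e dV hdV dW hdW) (-cmGramEntry L e dV hdV dW hdW) ((UnitaryDualPair.LocalSplitting.e₂ n).symm k)) (imagUnit L) σ))
          (sqrtAbs_signVec_ne_zero (IsCMField.complexConj_ne_one L) (cmPlaceOver_smul L) (complexConj_imagUnit L) (imagUnit_ne_zero L)
            (gramD_gram_realDiagonal_entry_ne_zero L e dV hdV dW hdW hdV0 hdW0) σ)
          (deltaIm_ne_zero (IsCMField.complexConj_ne_one L) (cmPlaceOver_smul L) (complexConj_imagUnit L) (imagUnit_ne_zero L) σ)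
          (formCongr_signFrame_eq L (IsCMField.complexConj L) (n + n) (IsCMField.complexConj_ne_one L) (cmPlaceOver L) (cmPlaceOver_smul L) _
            (gramD_gram_realDiagonal_entry_ne_zero L e dV hdV dW hdW hdV0 hdW0) (complexConj_imagUnit L) (imagUnit_ne_zero L) σ (cmPlaceOver_comap L)
            (gramD_eq_diagonal_cm L e dV hdV dW hdW) (J := hermD L e dV hdV dW hdW) rfl))
        (ι (NormedSpace.exp (t • (fromBlocks 1 1 (I • 1) (-(I • 1)) * A * ((2 : ℂ)⁻¹ • fromBlocks 1 (-(I • 1)) 1 (I • 1)) : Matrix (Fin n ⊕ Fin n) (Fin n ⊕ Fin n) ℂ))))))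
    rwa [show (((((UForm.relabel (Fin n) (Fin n) (PosIdx (signVec (cmPlaceOver L) (fun k => Sum.elim (cmGramEntry L e dV hdV dW hdW) (-cmGramEntry L e dV hdV dW hdW) ((UnitaryDualPair.LocalSplitting.e₂ n).symm k)) (imagUnit L) σ)) (NegIdx (signVec (cmPlaceOver L) (fun k => Sum.elim (cmGramEntry L e dV hdV dW hdW) (-cmGramEntry L e dV hdV dW hdW) ((UnitaryDualPair.LocalSplitting.e₂ n).symm k)) (imagUnit L) σ)) eSp eSq).symm
      ((toUFormEquiv (signSplit (signVec (cmPlaceOver L) (fun k => Sum.elim (cmGramEntry L e dV hdV dW hdW) (-cmGramEntry L e dV hdV dW hdW) ((UnitaryDualPair.LocalSplitting.e₂ n).symm k)) (imagUnit L) σ))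
          (sqrtAbs_signVec_ne_zero (IsCMField.complexConj_ne_one L) (cmPlaceOver_smul L) (complexConj_imagUnit L) (imagUnit_ne_zero L)
            (gramD_gram_realDiagonal_entry_ne_zero L e dV hdV dW hdW hdV0 hdW0) σ)
          (deltaIm_ne_zero (IsCMField.complexConj_ne_one L) (cmPlaceOver_smul L) (complexConj_imagUnit L) (imagUnit_ne_zero L) σ)
          (formCongr_signFrame_eq L (IsCMField.complexConj L) (n + n) (IsCMField.complexConj_ne_one L) (cmPlaceOver L) (cmPlaceOver_smul L) _
            (gramD_gram_realDiagonal_entry_ne_zero L e dV hdV dW hdW hdV0 hdW0) (complexConj_imagUnit L) (imagUnit_ne_zero L) σ (cmPlaceOver_comap L)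
            (gramD_eq_diagonal_cm L e dV hdV dW hdW) (J := hermD L e dV hdV dW hdW) rfl))
        (ι (NormedSpace.exp (t • (fromBlocks 1 1 (I • 1) (-(I • 1)) * A * ((2 : ℂ)⁻¹ • fromBlocks 1 (-(I • 1)) 1 (I • 1)) : Matrix (Fin n ⊕ Fin n) (Fin n ⊕ Fin n) ℂ)))))) : UForm (Fin n) (Fin n)) : GL (Fin n ⊕ Fin n) ℂ)) = expGL (t • A.submatrix θ θ) from
      Units.ext (by rw [coe_expGL]; exact hmat t)] at hg
  refine ⟨⟨A.submatrix θ θ, hmem⟩, fun s => ?_⟩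
  -- the chart value IS `relabel (expMem (s • Y′))` read back through `toUFormEquiv_σ`
  have key : (UForm.relabel (Fin n) (Fin n) (PosIdx (signVec (cmPlaceOver L) (fun k => Sum.elim (cmGramEntry L e dV hdV dW hdW) (-cmGramEntry L e dV hdV dW hdW) ((UnitaryDualPair.LocalSplitting.e₂ n).symm k)) (imagUnit L) σ)) (NegIdx (signVec (cmPlaceOver L) (fun k => Sum.elim (cmGramEntry L e dV hdV dW hdW) (-cmGramEntry L e dV hdV dW hdW) ((UnitaryDualPair.LocalSplitting.e₂ n).symm k)) (imagUnit L) σ)) eSp eSq).symm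
      ((toUFormEquiv (signSplit (signVec (cmPlaceOver L) (fun k => Sum.elim (cmGramEntry L e dV hdV dW hdW) (-cmGramEntry L e dV hdV dW hdW) ((UnitaryDualPair.LocalSplitting.e₂ n).symm k)) (imagUnit L) σ))
          (sqrtAbs_signVec_ne_zero (IsCMField.complexConj_ne_one L) (cmPlaceOver_smul L) (complexConj_imagUnit L) (imagUnit_ne_zero L)
            (gramD_gram_realDiagonal_entry_ne_zero L e dV hdV dW hdW hdV0 hdW0) σ)
          (deltaIm_ne_zero (IsCMField.complexConj_ne_one L) (cmPlaceOver_smul L) (complexConj_imagUnit L) (imagUnit_ne_zero L) σ)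
          (formCongr_signFrame_eq L (IsCMField.complexConj L) (n + n) (IsCMField.complexConj_ne_one L) (cmPlaceOver L) (cmPlaceOver_smul L) _
            (gramD_gram_realDiagonal_entry_ne_zero L e dV hdV dW hdW hdV0 hdW0) (complexConj_imagUnit L) (imagUnit_ne_zero L) σ (cmPlaceOver_comap L)
            (gramD_eq_diagonal_cm L e dV hdV dW hdW) (J := hermD L e dV hdV dW hdW) rfl))
        (ι (NormedSpace.exp (s • (fromBlocks 1 1 (I • 1) (-(I • 1)) * A * ((2 : ℂ)⁻¹ • fromBlocks 1 (-(I • 1)) 1 (I • 1)) : Matrix (Fin n ⊕ Fin n) (Fin n ⊕ Fin n) ℂ))))) =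
      ((uFormGroup (Fin n) (Fin n)).expMem ⟨((s • (⟨A.submatrix θ θ, hmem⟩ : ↥(uFormGroup (Fin n) (Fin n)).lie.toSubmodule) :
          ↥(uFormGroup (Fin n) (Fin n)).lie.toSubmodule) : Matrix (Fin n ⊕ Fin n) (Fin n ⊕ Fin n) ℂ), (s • (⟨A.submatrix θ θ, hmem⟩ :
          ↥(uFormGroup (Fin n) (Fin n)).lie.toSubmodule)).2⟩ : UForm (Fin n) (Fin n)) :=
    Subtype.ext (Units.ext (by rw [hmat s]; rfl))
  have key' : ι (NormedSpace.exp (s • (fromBlocks 1 1 (I • 1) (-(I • 1)) * A * ((2 : ℂ)⁻¹ • fromBlocks 1 (-(I • 1)) 1 (I • 1)) : Matrix (Fin n ⊕ Fin n) (Fin n ⊕ Fin n) ℂ))) =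
      (toUFormEquiv (signSplit (signVec (cmPlaceOver L) (fun k => Sum.elim (cmGramEntry L e dV hdV dW hdW) (-cmGramEntry L e dV hdV dW hdW) ((UnitaryDualPair.LocalSplitting.e₂ n).symm k)) (imagUnit L) σ))
          (sqrtAbs_signVec_ne_zero (IsCMField.complexConj_ne_one L) (cmPlaceOver_smul L) (complexConj_imagUnit L) (imagUnit_ne_zero L)
            (gramD_gram_realDiagonal_entry_ne_zero L e dV hdV dW hdW hdV0 hdW0) σ)
          (deltaIm_ne_zero (IsCMField.complexConj_ne_one L) (cmPlaceOver_smul L) (complexConj_imagUnit L) (imagUnit_ne_zero L) σ)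
          (formCongr_signFrame_eq L (IsCMField.complexConj L) (n + n) (IsCMField.complexConj_ne_one L) (cmPlaceOver L) (cmPlaceOver_smul L) _
            (gramD_gram_realDiagonal_entry_ne_zero L e dV hdV dW hdW hdV0 hdW0) (complexConj_imagUnit L) (imagUnit_ne_zero L) σ (cmPlaceOver_comap L)
            (gramD_eq_diagonal_cm L e dV hdV dW hdW) (J := hermD L e dV hdV dW hdW) rfl)).symm
        ((UForm.relabel (Fin n) (Fin n) (PosIdx (signVec (cmPlaceOver L) (fun k => Sum.elim (cmGramEntry L e dV hdV dW hdW) (-cmGramEntry L e dV hdV dW hdW) ((UnitaryDualPair.LocalSplitting.e₂ n).symm k)) (imagUnit L) σ)) (NegIdx (signVec (cmPlaceOver L) (fun k => Sum.elim (cmGramEntry L e dV hdV dW hdW) (-cmGramEntry L e dV hdV dW hdW) ((UnitaryDualPair.LocalSplitting.e₂ n).symm k)) (imagUnit L) σ)) eSp eSq)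
          ((uFormGroup (Fin n) (Fin n)).expMem ⟨((s • (⟨A.submatrix θ θ, hmem⟩ : ↥(uFormGroup (Fin n) (Fin n)).lie.toSubmodule) :
            ↥(uFormGroup (Fin n) (Fin n)).lie.toSubmodule) : Matrix (Fin n ⊕ Fin n) (Fin n ⊕ Fin n) ℂ), (s • (⟨A.submatrix θ θ, hmem⟩ :
            ↥(uFormGroup (Fin n) (Fin n)).lie.toSubmodule)).2⟩ : UForm (Fin n) (Fin n))) := by
    rw [← key, ContinuousMulEquiv.apply_symm_apply, ContinuousMulEquiv.symm_apply_apply]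
  rw [key', MonoidHom.comp_apply, placeSec_apply, UnitaryGroup.archSingle_apply]
  rfl

end CM

end Summit.HodgeConjecture.HodgeConjecture.Cruxes.HLiu418.K2LiuArchReadingChartPlaceSecArch

end
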